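import Summits.ABC.IUTFork.Repair.RHQ3LTailSigma8
import Summits.ABC.IUTFork.Repair.RHHeightClassGlue
import Literature.IUT.LogVolume.GenuineTowerDegreeBounds
import HarnessLib

/-!
# D-0079 RESCUE sub-cell R-H, ROUND 2 Q3 — row 8 «heightclass» (Σ₈): the OUT side on the genuine l-axis and the TYPED COMPARISON with the
# admissible l-window (seat abc-iut-rh2-q3-typ-1 g2)

PROOF-ONLY companion (0 definitions) of `RHQ3LTailSigma8` p478328 (IN side: `inSigma8_of_ltail[_of_isGalois]`, roughly `l ≥ max_v p_v^{H_v/4+1}`,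
`H_v := ord_v(q_v)/e(v|p)` the l-FREE normalised local height) and of g0's `RHQ3LTailConverse` p472523 (row 3 OUT side in `log_p [K:ℚ]`). Rung
LADDER-ABC:A2.RESCUE.H; ROUND2/START-HERE reading skeleton «Q3: per datum YES (∃ l₀(T)), uniformly NO; l₀ exponential in local height … vs the certificate's
admissible l-window … typed comparison owed (Q3-typ lane)»; MIN-SLICE (iv). TAKES NO SIDE on [IUTchIII] Cor. 3.12 or on any author; nothing here asserts abc;
`HBand`/`CertVal`/`StrictMinPow` (abc-iut-rh-typ-8 p459046) and `InSigma8` (abc-iut-rh2-xi-2 p470383) are row 8's HYPOTHESIS vocabulary, consumed BY NAME;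
«outside Σ₈ at l» = the hypothesis FAILS as typed at that `l`, never a statement about print.

* §1 `certVal_ge_neg_log_mul` — EVERY certified member valuation at `(p, e)` satisfies `r ≥ −(⌊log_p e⌋ + 1)·e` (untied: `r = p^t − t·e` with
  `p^{t−1} < e`, `RHHeightClassGlue.strictTurning_of_strictMin`; fallback `r = e ≥ 0`).
* §2 `not_inSigma8_of_heavy` — at the GENUINE datum `Cor312Prov.pilotDataOfK D K`: ONE bad place `w | p` (over `v`) with
  `4·l·e(v|p)·(⌊log_p e_w⌋ + 2) + 2 ≤ (l − 3)·ord_v(q_v)` puts the datum OUTSIDE Σ₈ at this `l` (top label `j = l⋆`, g0's integer test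
  `RH.Q3LTailBand.not_band_of_heavy`, `2l·P_q(w) = e(w|v)·ord_v(q_v)`, `e_w = e(v|p)·e(w|v)`); `not_inSigma8_of_heavy_of_ramIdx_le` — the same with
  `⌊log_p B⌋` for any bound `e_w ≤ B` (e.g. `B = [K:ℚ]`, `ramificationIdx_int_le_finrank_rat`). Read: OUT at `l` as soon as
  `H_v ≥ (4l/(l−3))·(log_p e_w + 2) + 1`, and `e_w ≤ [K:ℚ]` — the row-8 twin of g0's `not_hStar_pilotDataOfK_of_heavy_top`.
* §3 THE WINDOW COMPARISON at a genuine Θ-VOLUME datum `T : Cor22.ThetaVolumeDatumAt P l` (the binder of the certificates of record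
  `Conditional.abc_of_SH_v10K_window*`): `[K:ℚ] ≤ 184320·[F_tpd:ℚ]·l⁴` (abc-iut-w5-d194 `finrank_rat_K_le` / `ramificationIdx_int_le_of_datum`, [IUTchIV]
  Thm. 1.10 Step (ii)), so **`not_inSigma8_datum_of_heavy`**: `4·l·e(v|p)·(⌊log_p(184320·deg P·l⁴)⌋ + 2) + 2 ≤ (l−3)·ord_v(q_v)` at one bad place ⟹
  `¬ InSigma8 T.D`; and uniformly below any level bound `L ≥ l`, **`not_inSigma8_datum_of_heavy_of_le`**:
  `e(v|p)·(10·(⌊log_p(184320·deg P·L⁴)⌋ + 2) + 1) ≤ ord_v(q_v)` ⟹ `¬ InSigma8 T.D` at EVERY level `5 ≤ l ≤ L`. With `L :=` the TOP of the admissible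
  window of [IUTchIV] Cor. 2.2 (ii) (P1) (`l ≤ 10δ·h^{1/2}·log(2δh)`, kernel twin `Literature.IUT.LogVolume.Cor22.partII_of_displayWindow` p472503 /
  `Cor22.Data.P1hi`): a curve with ONE bad place of normalised local height `H_v ≥ 10·log_p(184320·deg·L⁴) + 21 = O(log h)` is OUTSIDE Σ₈ THROUGHOUT
  the window, while the IN side needs `l ≳ p^{H_v/4}`: «datum ∈ Σ₈ somewhere in its window» forces `H_v = O(log_p h)` at every bad place — exponential
  vs. polylog, the typed form of «CONDITIONAL, generically disjoint for deep data» (numerics of record: rh-num-1 Q3-L0EXACT / Q3-DATA v1.3, HEX inside (P1)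
  iff `k ≤ 23`; frey 36/37).
[cite: Mochizuki2012, IUTchI Def. 3.1 (b)(c) pp. 61–62, Ex. 3.2 (iv) p. 71; IUTchIV Prop. 1.2 (i)(ii) p. 10, Thm. 1.10 Step (ii) p. 24, Cor. 2.2 (ii) p. 45]
[cite: NeukirchANT1999, Ch. I Prop. (8.2), Ch. II Prop. (5.5), (6.8)] [cite: DupuyHilado2025, §3.3, §3.4] [claim: Mochizuki2012, status: disputed] for every IUT locution.
-/

noncomputable section

open Set Function NumberField IsDedekindDomain

namespace Summit.ABC.IUTFork.Repair.RH.Q3LTailSigma8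

open Literature.IUT.LogThetaLattice Literature.IUT.LogVolume Literature.IUT.HodgeTheaters
open Summit.ABC.IUTFork.Thm311 Summit.ABC.IUTFork.Thm311.Real Summit.ABC.IUTFork.Cor312Prov Summit.ABC.IUTFork.Repair.RHHeightClass
  Summit.ABC.IUTFork.Repair.RH.Q3LTailBand

/-! ## §1. Every certified member valuation is `≥ −(⌊log_p e⌋ + 1)·e` -/

section CertVal

/-- **The untied minimiser index is at most `⌊log_p e⌋ + 1`**: a strict minimum of `s ↦ p^s − s·e` at `t` has `p^a(p−1) < e` for `a < t`
(`RHHeightClassGlue.strictTurning_of_strictMin`), so `p^{t−1} < e` and `t − 1 ≤ ⌊log_p e⌋` (`Nat.le_log_of_pow_le`). [cite: NeukirchANT1999, Ch. II Prop. (5.5)] -/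
theorem strictMin_index_le_log_succ {p e t : ℕ} (hp : 2 ≤ p) {r : ℤ} (ht : (p : ℤ) ^ t - t * e = r)
    (hs : ∀ t' : ℕ, t' ≠ t → r < (p : ℤ) ^ t' - t' * e) : t ≤ Nat.log p e + 1 := by
  rcases Nat.eq_zero_or_pos t with h0 | h0
  · omega
  · obtain ⟨hlo, -⟩ := RHHeightClassGlue.strictTurning_of_strictMin (p := p) (e := e) (by omega) ht hs
    have h1 := hlo (t - 1) (by omega)
    have hp1 : (1 : ℤ) ≤ (p : ℤ) - 1 := by
      have : (2 : ℤ) ≤ (p : ℤ) := by exact_mod_cast hp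
      linarith
    have hpow0 : (0 : ℤ) ≤ (p : ℤ) ^ (t - 1) := pow_nonneg (by positivity) _
    have h2 : (p : ℤ) ^ (t - 1) ≤ e := by nlinarith
    have h3 : p ^ (t - 1) ≤ e := by exact_mod_cast h2
    have h4 : t - 1 ≤ Nat.log p e := Nat.le_log_of_pow_le (by omega) h3
    omega

/-- **EVERY certified member valuation is `≥ −(⌊log_p e⌋ + 1)·e`** (`p ≥ 2`): untied `r = p^t − t·e ≥ −t·e` with `t ≤ ⌊log_p e⌋ + 1`
(`strictMin_index_le_log_succ`); fallback `r = e ≥ 0`. This is the `T` of g0's `RH.Q3LTailBand.not_band_of_heavy` at EVERY place, ties included.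
[cite: NeukirchANT1999, Ch. II Prop. (5.5)] -/
theorem certVal_ge_neg_log_mul {p e : ℕ} (hp : 2 ≤ p) {r : ℤ} (hr : CertVal p e r) :
    -((((Nat.log p e + 1 : ℕ)) : ℤ) * e) ≤ r := by
  rcases hr with ⟨t, ht, hs⟩ | hr
  · have htle := strictMin_index_le_log_succ hp ht hs
    have hpow0 : (0 : ℤ) ≤ (p : ℤ) ^ t := pow_nonneg (by positivity) _
    have he0 : (0 : ℤ) ≤ (e : ℤ) := by positivity
    have htle' : (t : ℤ) ≤ ((Nat.log p e + 1 : ℕ) : ℤ) := by exact_mod_cast htle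
    rw [← ht]
    nlinarith [mul_le_mul_of_nonneg_right htle' he0]
  · rw [hr]
    have he0 : (0 : ℤ) ≤ (e : ℤ) := by positivity
    nlinarith

end CertVal

/-! ## §2. The OUT side at the genuine `K`-level datum -/

section Genuine

variable {F K Fbar : Type} [Field F] [NumberField F] [Field K] [NumberField K] [Algebra F K] [Field Fbar]
  [Algebra F Fbar] [Algebra K Fbar] {E : WeierstrassCurve F} [E.IsElliptic] {l : ℕ} {Pb : BadPlacePredicates K}
  (D : InitialThetaData F K Fbar E l Pb)

/-- **ONE HEAVY BAD PLACE PUTS THE GENUINE DATUM OUTSIDE Σ₈.** At a bad place `w | p` of `pilotDataOfK D K` over `v = w ∩ F`, with `e_w = ramIdx K w`,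
`e(v|p) = ramIdx F v`, `n = ord_v(q_v)`: if `4·l·e(v|p)·(⌊log_p e_w⌋ + 2) + 2 ≤ (l − 3)·n` then `¬ InSigma8 D`. Mechanism: at the TOP label `j = l⋆`
the band cell needs `(j²−1)·P_q(w) ≤ j·(e_w − r) + (1 − r)` for a certified `r ≥ −(⌊log_p e_w⌋+1)·e_w` (`certVal_ge_neg_log_mul`), while
`8l·(j²−1)·P_q(w) = (l−3)(l+1)·e(w|v)·n` and `e_w = e(v|p)·e(w|v)`: g0's `not_band_of_heavy`. Roughly: OUT at `l` once `H_v = n/e(v|p) ≥ (4l/(l−3))(log_p e_w + 2) + 1`.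
[cite: Mochizuki2012, IUTchI Def. 3.1 (c) p. 62, Ex. 3.2 (iv) p. 71; IUTchIV Prop. 1.2 (i)(ii) p. 10] [claim: Mochizuki2012, status: disputed] -/
theorem not_inSigma8_of_heavy (pp : Nat.Primes) (w : (thetaIndex (pilotDataOfK D K)).Fibre (.inr pp))
    (hw : haveI : Fact (pp : ℕ).Prime := ⟨pp.2⟩; placeOf (pilotDataOfK D K) pp.1 w ∈ (pilotDataOfK D K).S)
    (h : haveI : Fact (pp : ℕ).Prime := ⟨pp.2⟩
      4 * l * ramIdx F (finBelow F K (placeOf (pilotDataOfK D K) pp.1 w)) *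
            (Nat.log (pp : ℕ) (ramIdx K (placeOf (pilotDataOfK D K) pp.1 w)) + 2) + 2 ≤
        (l - 3) * qParamOrd E (finBelow F K (placeOf (pilotDataOfK D K) pp.1 w))) :
    ¬ RH.InSigmaDatum.InSigma8 D := by
  haveI hF : Fact (pp : ℕ).Prime := ⟨pp.2⟩
  intro hH
  rw [RH.InSigmaDatum.inSigma8_iff] at hH
  have h5 : 5 ≤ l := D.five_le_l
  have hleq : l = 2 * (pilotDataOfK D K).lstar + 1 := by
    have := (pilotDataOfK D K).l_eq
    rwa [pilotDataOfK_l] at this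
  -- the top label `j = l⋆`, i.e. `i = l⋆ − 1`
  obtain ⟨-, -, r, hr, hcell⟩ := hH pp ⟨(pilotDataOfK D K).lstar - 1, by omega⟩ w hw
  set w₀ := placeOf (pilotDataOfK D K) pp.1 w with hw₀
  set v := finBelow F K w₀ with hv
  obtain ⟨P, hP, -, h2lP⟩ := exists_nat_qPilot_pilotDataOfK D hw
  have htower : w₀.asIdeal.ramificationIdx ℤ = ramIdx F v * Ideal.ramificationIdx' v.asIdeal w₀.asIdeal :=
    ThetaData.absRamificationIdx_eq_ramIdx_mul (F := F) w₀
  have hVF : FinitePlace.mk v ∈ D.VFbad := (mem_pilotDataOfK_S_iff D K w₀).mp hw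
  have hlr : l ≤ Ideal.ramificationIdx' v.asIdeal w₀.asIdeal := ThetaData.l_le_ramificationIdx_of_under_mem_VFbad D hVF
  have he0 : 1 ≤ ramIdx F v := Nat.one_le_iff_ne_zero.2 (ramIdx_ne_zero F v)
  have heq : ramIdx K w₀ = w₀.asIdeal.ramificationIdx ℤ := ramIdx_eq K w₀
  -- the certified `r` is `≥ −T·e_w`, `T = ⌊log_p e_w⌋ + 1`
  have hrT := certVal_ge_neg_log_mul pp.2.two_le hr
  -- integer bookkeeping
  set T : ℕ := Nat.log (pp : ℕ) (ramIdx K w₀) + 1 with hT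
  set g : ℕ := Ideal.ramificationIdx' v.asIdeal w₀.asIdeal with hg
  set ev : ℕ := ramIdx F v with hev
  set n : ℕ := qParamOrd E v with hn
  set ls : ℕ := (pilotDataOfK D K).lstar with hls
  have hew : ramIdx K w₀ = ev * g := by rw [heq, htower]
  have hj : ((((pilotDataOfK D K).lstar - 1 : ℕ)) : ℝ) + 1 = ((ls : ℕ) : ℝ) := by
    rw [Nat.cast_sub (show 1 ≤ (pilotDataOfK D K).lstar by omega)]
    push_cast
    ring
  simp only [hj] at hcell
  rw [hP, hew] at hcell
  -- the real cell is the integer cell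
  have hcellZ : (((ls : ℤ)) ^ 2 - 1) * (P : ℤ) ≤ (ls : ℤ) * (((ev * g : ℕ) : ℤ) - r) + (1 - r) := by
    have : ((((ls : ℤ)) ^ 2 - 1) * (P : ℤ) : ℤ) ≤ ((ls : ℤ) * (((ev * g : ℕ) : ℤ) - r) + (1 - r) : ℤ) := by
      have h' : ((((((ls : ℤ)) ^ 2 - 1) * (P : ℤ) : ℤ)) : ℝ) ≤ ((((ls : ℤ) * (((ev * g : ℕ) : ℤ) - r) + (1 - r) : ℤ)) : ℝ) := by
        push_cast at hcell ⊢
        exact hcell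
      exact_mod_cast h'
    exact this
  -- g0's refuting test with `T`, at `j = l⋆`, `e = e_v·g`, `m = P`
  have hT' : T = Nat.log (pp : ℕ) (ev * g) + 1 := by rw [hT, hew]
  rw [hew] at hrT
  refine not_band_of_heavy (j := (ls : ℤ)) (e := ((ev * g : ℕ) : ℤ)) (m := (P : ℤ)) (r := r) (T := (T : ℤ)) (by positivity) ?_ ?_ hcellZ
  · have hr' := hrT
    push_cast at hr' ⊢
    linarith
  · -- `8l·[ls·e·(T+1) + T·e + 1] < 8l·(ls²−1)·P`
    have hl0 : (0 : ℤ) < l := by exact_mod_cast (show 0 < l by omega)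
    have hlsZ : (l : ℤ) = 2 * ls + 1 := by rw [hls]; exact_mod_cast hleq
    have h2lPZ : 2 * (l : ℤ) * P = (g : ℤ) * n := by rw [hg, hn]; exact_mod_cast h2lP
    have hg5 : (5 : ℤ) ≤ g := by rw [hg]; exact_mod_cast (h5.trans hlr)
    have hev1 : (1 : ℤ) ≤ ev := by rw [hev]; exact_mod_cast he0
    have hT1 : (1 : ℤ) ≤ T := by rw [hT]; push_cast; linarith [Nat.cast_nonneg (α := ℤ) (Nat.log (pp : ℕ) (ramIdx K w₀))]
    have hhyp : 4 * (l : ℤ) * ev * ((T : ℤ) + 1) + 2 ≤ ((l : ℤ) - 3) * n := by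
      have hT2 : Nat.log (pp : ℕ) (ramIdx K w₀) + 2 = T + 1 := by rw [hT]
      have h' : 4 * l * ev * (T + 1) + 2 ≤ (l - 3) * n := by rw [← hT2, hev, hn]; exact h
      have h3 : 3 ≤ l := by omega
      have : ((4 * l * ev * (T + 1) + 2 : ℕ) : ℤ) ≤ (((l - 3) * n : ℕ) : ℤ) := by exact_mod_cast h'
      push_cast [Nat.cast_sub h3] at this
      linarith
    refine lt_of_mul_lt_mul_left (a := 8 * (l : ℤ)) ?_ (by positivity)
    -- left side `8l(ls e (T+1) + T e + 1) = 4 l e ((l+1)(T+1) − 2) + 8 l`, right side `(l−3)(l+1) g n`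
    have hR : 8 * (l : ℤ) * (((ls : ℤ) ^ 2 - 1) * P) = ((l : ℤ) - 3) * ((l : ℤ) + 1) * g * n := by
      have : 8 * (l : ℤ) * (((ls : ℤ) ^ 2 - 1) * P) = (4 * ((ls : ℤ) ^ 2 - 1)) * (2 * (l : ℤ) * P) := by ring
      rw [this, h2lPZ, hlsZ]; ring
    have hL : 8 * (l : ℤ) * ((ls : ℤ) * ((((ev * g : ℕ) : ℤ)) * ((T : ℤ) + 1)) + (T : ℤ) * ((ev * g : ℕ) : ℤ) + 1) =
        4 * (l : ℤ) * (ev * g) * (((l : ℤ) + 1) * ((T : ℤ) + 1) - 2) + 8 * l := by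
      push_cast; rw [hlsZ]; ring
    rw [hR, hL]
    have hl5 : (5 : ℤ) ≤ l := by exact_mod_cast h5
    nlinarith [mul_le_mul_of_nonneg_left hhyp (by positivity : (0 : ℤ) ≤ ((l : ℤ) + 1) * g),
      mul_nonneg (by linarith : (0 : ℤ) ≤ ev - 1) (by linarith : (0 : ℤ) ≤ g - 1), hg5, hev1, hT1]

/-- **OUT with any bound on `e_w`** (monotonicity of `⌊log_p ·⌋`): if `e_w ≤ B` and `4·l·e(v|p)·(⌊log_p B⌋ + 2) + 2 ≤ (l−3)·ord_v(q_v)` at a bad place,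
then `¬ InSigma8 D`. With `B := [K:ℚ]` (`ramificationIdx_int_le_finrank_rat`) this is the row-8 twin of g0's `not_hStar_pilotDataOfK_of_heavy_top`.
[cite: NeukirchANT1999, Ch. I Prop. (8.2)] [claim: Mochizuki2012, status: disputed] -/
theorem not_inSigma8_of_heavy_of_ramIdx_le (pp : Nat.Primes) (w : (thetaIndex (pilotDataOfK D K)).Fibre (.inr pp))
    (hw : haveI : Fact (pp : ℕ).Prime := ⟨pp.2⟩; placeOf (pilotDataOfK D K) pp.1 w ∈ (pilotDataOfK D K).S)
    (B : ℕ) (hB : haveI : Fact (pp : ℕ).Prime := ⟨pp.2⟩; ramIdx K (placeOf (pilotDataOfK D K) pp.1 w) ≤ B)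
    (h : haveI : Fact (pp : ℕ).Prime := ⟨pp.2⟩
      4 * l * ramIdx F (finBelow F K (placeOf (pilotDataOfK D K) pp.1 w)) * (Nat.log (pp : ℕ) B + 2) + 2 ≤
        (l - 3) * qParamOrd E (finBelow F K (placeOf (pilotDataOfK D K) pp.1 w))) :
    ¬ RH.InSigmaDatum.InSigma8 D := by
  haveI hF : Fact (pp : ℕ).Prime := ⟨pp.2⟩
  refine not_inSigma8_of_heavy D pp w hw (le_trans ?_ h)
  have hlog : Nat.log (pp : ℕ) (ramIdx K (placeOf (pilotDataOfK D K) pp.1 w)) ≤ Nat.log (pp : ℕ) B := Nat.log_mono_right hB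
  have : 4 * l * ramIdx F (finBelow F K (placeOf (pilotDataOfK D K) pp.1 w)) *
        (Nat.log (pp : ℕ) (ramIdx K (placeOf (pilotDataOfK D K) pp.1 w)) + 2) ≤
      4 * l * ramIdx F (finBelow F K (placeOf (pilotDataOfK D K) pp.1 w)) * (Nat.log (pp : ℕ) B + 2) :=
    Nat.mul_le_mul_left _ (by omega)
  omega

/-- **The absolute-degree form**: `e_w ≤ [K:ℚ]`, so `4·l·e(v|p)·(⌊log_p [K:ℚ]⌋ + 2) + 2 ≤ (l−3)·ord_v(q_v)` at one bad place ⟹ `¬ InSigma8 D`.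
[cite: NeukirchANT1999, Ch. I Prop. (8.2)] [claim: Mochizuki2012, status: disputed] -/
theorem not_inSigma8_of_heavy_finrank (pp : Nat.Primes) (w : (thetaIndex (pilotDataOfK D K)).Fibre (.inr pp))
    (hw : haveI : Fact (pp : ℕ).Prime := ⟨pp.2⟩; placeOf (pilotDataOfK D K) pp.1 w ∈ (pilotDataOfK D K).S)
    (h : haveI : Fact (pp : ℕ).Prime := ⟨pp.2⟩
      4 * l * ramIdx F (finBelow F K (placeOf (pilotDataOfK D K) pp.1 w)) * (Nat.log (pp : ℕ) (Module.finrank ℚ K) + 2) + 2 ≤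
        (l - 3) * qParamOrd E (finBelow F K (placeOf (pilotDataOfK D K) pp.1 w))) :
    ¬ RH.InSigmaDatum.InSigma8 D := by
  haveI hF : Fact (pp : ℕ).Prime := ⟨pp.2⟩
  refine not_inSigma8_of_heavy_of_ramIdx_le D pp w hw (Module.finrank ℚ K) ?_ h
  rw [ramIdx_eq K]
  exact ramificationIdx_int_le_finrank_rat _

end Genuine

/-! ## §3. The comparison with the admissible l-window at a genuine Θ-volume datum -/

section Window

open Literature.IUT.LogVolume.Cor22 Literature.NumberTheory.DiophantineGeometry.GenEll

variable {P : NFPoint} {l : ℕ} (T : ThetaVolumeDatumAt P l)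

/-- **OUT at a genuine Θ-volume datum, degree discharged**: `[K:ℚ] ≤ 184320·deg(P)·l⁴` ([IUTchIV] Thm. 1.10 Step (ii), abc-iut-w5-d194
`ThetaVolumeDatumAt.ramificationIdx_int_le_of_datum`), so ONE bad place with `4·l·e(v|p)·(⌊log_p(184320·deg P·l⁴)⌋ + 2) + 2 ≤ (l−3)·ord_v(q_v)` gives
`¬ InSigma8 T.D`. [cite: Mochizuki2012, IUTchIV Thm. 1.10 proof Step (ii) p. 24] [claim: Mochizuki2012, status: disputed] -/
theorem not_inSigma8_datum_of_heavy (pp : Nat.Primes)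
    (w : letI := T.instFieldF; letI := T.instNumberFieldF; letI := T.instAlgebraF; letI := T.instFieldK;
      letI := T.instNumberFieldK; letI := T.instAlgebraK; letI := T.instFieldFbar; letI := T.instAlgebraFbar;
      letI := T.instAlgebraKFbar; letI := T.instIsElliptic;
      (thetaIndex (pilotDataOfK T.D T.K)).Fibre (.inr pp))
    (hw : letI := T.instFieldF; letI := T.instNumberFieldF; letI := T.instAlgebraF; letI := T.instFieldK;
      letI := T.instNumberFieldK; letI := T.instAlgebraK; letI := T.instFieldFbar; letI := T.instAlgebraFbar;
      letI := T.instAlgebraKFbar; letI := T.instIsElliptic; haveI : Fact (pp : ℕ).Prime := ⟨pp.2⟩;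
      placeOf (pilotDataOfK T.D T.K) pp.1 w ∈ (pilotDataOfK T.D T.K).S)
    (h : letI := T.instFieldF; letI := T.instNumberFieldF; letI := T.instAlgebraF; letI := T.instFieldK;
      letI := T.instNumberFieldK; letI := T.instAlgebraK; letI := T.instFieldFbar; letI := T.instAlgebraFbar;
      letI := T.instAlgebraKFbar; letI := T.instIsElliptic; haveI : Fact (pp : ℕ).Prime := ⟨pp.2⟩;
      4 * l * ramIdx T.F (finBelow T.F T.K (placeOf (pilotDataOfK T.D T.K) pp.1 w)) * (Nat.log (pp : ℕ) (184320 * P.degree * l ^ 4) + 2) + 2 ≤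
        (l - 3) * qParamOrd T.E (finBelow T.F T.K (placeOf (pilotDataOfK T.D T.K) pp.1 w))) :
    letI := T.instFieldF; letI := T.instNumberFieldF; letI := T.instAlgebraF; letI := T.instFieldK;
    letI := T.instNumberFieldK; letI := T.instAlgebraK; letI := T.instFieldFbar; letI := T.instAlgebraFbar;
    letI := T.instAlgebraKFbar; letI := T.instIsElliptic;
    ¬ RH.InSigmaDatum.InSigma8 T.D := by
  letI := T.instFieldF; letI := T.instNumberFieldF; letI := T.instAlgebraF; letI := T.instFieldK
  letI := T.instNumberFieldK; letI := T.instAlgebraK; letI := T.instFieldFbar; letI := T.instAlgebraFbar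
  letI := T.instAlgebraKFbar; letI := T.instIsElliptic
  haveI hF : Fact (pp : ℕ).Prime := ⟨pp.2⟩
  refine not_inSigma8_of_heavy_of_ramIdx_le T.D pp w hw (184320 * P.degree * l ^ 4) ?_ h
  rw [ramIdx_eq T.K]
  exact T.ramificationIdx_int_le_of_datum _

/-- **THE WINDOW COMPARISON.** For a genuine Θ-volume datum of ANY level `l ≤ L`: ONE bad place with
`e(v|p)·(10·(⌊log_p(184320·deg P·L⁴)⌋ + 2) + 1) ≤ ord_v(q_v)` — i.e. normalised local height `H_v ≥ 10·⌊log_p(184320·deg·L⁴)⌋ + 21`, a bound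
POLYLOGARITHMIC in `L` — puts the datum OUTSIDE Σ₈ (`4l/(l−3) ≤ 10` for `l ≥ 5`). Read with `L :=` the top `10δ·h^{1/2}·log(2δh)` of the admissible
window of [IUTchIV] Cor. 2.2 (ii) (P1) (where alone the certificate consumes `hSHw`, `Cor22.partII_of_displayWindow`): such a datum is outside Σ₈
THROUGHOUT its window, whereas the IN side (`inSigma8_of_ltail_of_isGalois`) starts at `l ≍ p^{H_v/4}` — «∈ Σ₈ somewhere in the window» forces
`H_v = O(log_p h)` at every bad place. [cite: Mochizuki2012, IUTchIV Thm. 1.10 Step (ii) p. 24, Cor. 2.2 (ii) (P1) p. 45] [claim: Mochizuki2012, status: disputed] -/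
theorem not_inSigma8_datum_of_heavy_of_le (L : ℕ) (hlL : l ≤ L) (pp : Nat.Primes)
    (w : letI := T.instFieldF; letI := T.instNumberFieldF; letI := T.instAlgebraF; letI := T.instFieldK;
      letI := T.instNumberFieldK; letI := T.instAlgebraK; letI := T.instFieldFbar; letI := T.instAlgebraFbar;
      letI := T.instAlgebraKFbar; letI := T.instIsElliptic;
      (thetaIndex (pilotDataOfK T.D T.K)).Fibre (.inr pp))
    (hw : letI := T.instFieldF; letI := T.instNumberFieldF; letI := T.instAlgebraF; letI := T.instFieldK;
      letI := T.instNumberFieldK; letI := T.instAlgebraK; letI := T.instFieldFbar; letI := T.instAlgebraFbar;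
      letI := T.instAlgebraKFbar; letI := T.instIsElliptic; haveI : Fact (pp : ℕ).Prime := ⟨pp.2⟩;
      placeOf (pilotDataOfK T.D T.K) pp.1 w ∈ (pilotDataOfK T.D T.K).S)
    (h : letI := T.instFieldF; letI := T.instNumberFieldF; letI := T.instAlgebraF; letI := T.instFieldK;
      letI := T.instNumberFieldK; letI := T.instAlgebraK; letI := T.instFieldFbar; letI := T.instAlgebraFbar;
      letI := T.instAlgebraKFbar; letI := T.instIsElliptic; haveI : Fact (pp : ℕ).Prime := ⟨pp.2⟩;
      ramIdx T.F (finBelow T.F T.K (placeOf (pilotDataOfK T.D T.K) pp.1 w)) * (10 * (Nat.log (pp : ℕ) (184320 * P.degree * L ^ 4) + 2) + 1) ≤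
        qParamOrd T.E (finBelow T.F T.K (placeOf (pilotDataOfK T.D T.K) pp.1 w))) :
    letI := T.instFieldF; letI := T.instNumberFieldF; letI := T.instAlgebraF; letI := T.instFieldK;
    letI := T.instNumberFieldK; letI := T.instAlgebraK; letI := T.instFieldFbar; letI := T.instAlgebraFbar;
    letI := T.instAlgebraKFbar; letI := T.instIsElliptic;
    ¬ RH.InSigmaDatum.InSigma8 T.D := by
  letI := T.instFieldF; letI := T.instNumberFieldF; letI := T.instAlgebraF; letI := T.instFieldK
  letI := T.instNumberFieldK; letI := T.instAlgebraK; letI := T.instFieldFbar; letI := T.instAlgebraFbar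
  letI := T.instAlgebraKFbar; letI := T.instIsElliptic
  haveI hF : Fact (pp : ℕ).Prime := ⟨pp.2⟩
  refine not_inSigma8_datum_of_heavy T pp w hw ?_
  have h5 : 5 ≤ l := T.D.five_le_l
  set ev := ramIdx T.F (finBelow T.F T.K (placeOf (pilotDataOfK T.D T.K) pp.1 w)) with hev
  set n := qParamOrd T.E (finBelow T.F T.K (placeOf (pilotDataOfK T.D T.K) pp.1 w)) with hn
  have he1 : 1 ≤ ev := Nat.one_le_iff_ne_zero.2 (ramIdx_ne_zero T.F _)
  -- `⌊log_p(C·l⁴)⌋ ≤ ⌊log_p(C·L⁴)⌋`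
  have hA : Nat.log (pp : ℕ) (184320 * P.degree * l ^ 4) + 2 ≤ Nat.log (pp : ℕ) (184320 * P.degree * L ^ 4) + 2 := by
    have : 184320 * P.degree * l ^ 4 ≤ 184320 * P.degree * L ^ 4 :=
      Nat.mul_le_mul_left _ (Nat.pow_le_pow_left hlL 4)
    have := Nat.log_mono_right (b := (pp : ℕ)) this
    omega
  set A := Nat.log (pp : ℕ) (184320 * P.degree * L ^ 4) + 2 with hAdef
  -- `4 l e_v A_l + 2 ≤ 4 l e_v A + 2 ≤ (l−3) e_v (10A + 1) ≤ (l−3) n`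
  have h1 : 4 * l * ev * (Nat.log (pp : ℕ) (184320 * P.degree * l ^ 4) + 2) ≤ 4 * l * ev * A := Nat.mul_le_mul_left _ hA
  have h2 : 4 * l * ev * A + 2 ≤ (l - 3) * (ev * (10 * A + 1)) := by
    obtain ⟨m, rfl⟩ := Nat.exists_eq_add_of_le h5
    have h53 : 5 + m - 3 = 2 + m := by omega
    rw [h53]
    have key : (2 + m) * (ev * (10 * A + 1)) = 4 * (5 + m) * ev * A + 2 * ev + 6 * (m * ev * A) + m * ev := by ring
    rw [key]
    linarith [he1, Nat.zero_le (m * ev * A), Nat.zero_le (m * ev)]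
  have h4 : (l - 3) * (ev * (10 * A + 1)) ≤ (l - 3) * n := Nat.mul_le_mul_left _ h
  omega

end Window

end Summit.ABC.IUTFork.Repair.RH.Q3LTailSigma8

end
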